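import Summits.CriticalPhenomena.PercolationContinuityZ3.Theorems.Transplant.FKConnectivityAllQForestToggleE
import Summits.CriticalPhenomena.PercolationContinuityZ3.Theorems.Transplant.FKConnectivityAllQForestTreeLevelPairCell
import HarnessLib

/-!
# Level-free reductions of the square-free adjacent forest Rayleigh node at vertices of small degree NEAR THE HUB

Support file (`--supports stmt-CriticalPhenomena-4575`), FK sub-lane `prim-bschramm-fk-1` (generation 30) of the post-continuity
programme; builds on p205010 (kernel theorem, internal audit signed; external expert review pending).  No definitions, no named facts,
no sorries; standard axioms.

Pieces of the level-free vertex-elimination induction 'CONJECTURE H1′ (`TwoCellBoundOn`) ⇒ `AdjForestRayleighNoSqOn`' (memo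
bschramm/FROM-fk-1-g30-LAMAN-IDENTITIES.md §4) that do NOT need the conjecture and are not far-vertex steps:
* **`fibreCount_forest_pendantFree`** — a vertex `z` carrying exactly one FREE pair `zc` doubles every forest fibre count of the rest
  (`z` is a leaf of one class and isolated in the other);
* **`adjForestNoSq_fibre_of_hubDegTwo`** — if the hub `o` meets no pair other than `e = ov`, `f = oy` (both free), then `bad ≤ good`
  (drop `f` from the first class: `o` is isolated in the partner, which therefore absorbs `f`);
* **`adjForestNoSq_bad_eq_good_of_pendantEnd`** / **`adjForestNoSq_fibre_of_pendantEnd`** — if the end `v` of `e` meets no pair other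
  than `e` (free), then `bad = good`: by g30's e-toggle (`adjForestNoSq_fibre_iff_joinB`) the node lives on the colourings whose second class
  joins `o` to `v`, and there are none (`v` is isolated in the second class).
[cite: CibulkaHladkyLaCroixWagner2008, Thm. 1 (p. 2), Cases 0–2 (p. 4)] [cite: SempleWelsh2008, Conj. 1.1 (p. 2)] [cite: Linusson2011, Prop. 2.6]
[cite: Grimmett2006, §1.5 (p. 13)]
-/

noncomputable section

namespace Summit.CriticalPhenomena.PercolationContinuityZ3.Theorems
namespace FK

open MeasureTheory Set Literature.Probability.LatticeModels Literature.Probability.Percolation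
open scoped Classical symmDiff

variable {V : Type*} [Fintype V]

section PendantFree

variable {M' u₀ : BondConfig V} {z c : V} {P Q : Set (BondConfig V)}

/-- **A pendant FREE pair doubles the count**: if `z` lies in no pair of `M′ ∪ u₀`, `z ≠ c`, and `P, Q` do not see the pair `zc`, then
`#_{(M′ ∪ {zc}, u₀)}(Fo ∩ P, Fo ∩ Q) = 2 · #_{(M′, u₀)}(Fo ∩ P, Fo ∩ Q)` (the pair goes to either class; `z` is a leaf there).
[cite: CibulkaHladkyLaCroixWagner2008, Cases 0–1 (p. 4)] [cite: Linusson2011, Prop. 2.6] -/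
theorem fibreCount_forest_pendantFree (hz : ∀ g ∈ M' ∪ u₀, z ∉ g) (hzc : z ≠ c)
    (hP : ∀ ω, insert s(z, c) ω ∈ P ↔ ω ∈ P) (hQ : ∀ ω, insert s(z, c) ω ∈ Q ↔ ω ∈ Q) :
    fibreCount (insert s(z, c) M') u₀ (forestEv V ∩ P) (forestEv V ∩ Q) = 2 * fibreCount M' u₀ (forestEv V ∩ P) (forestEv V ∩ Q) := by
  have hgM : s(z, c) ∉ M' := fun h => hz _ (Or.inl h) (Sym2.mem_mk_left _ _)
  rw [fibreCount_insert_one hgM]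
  -- on the rest fibre `z` is isolated in both classes
  have hisoω : ∀ ω : BondConfig V, ω \ M' = u₀ → ∀ p ∈ ω, z ∉ p := fun ω hω p hp =>
    hz p ((subset_union_of_fibre hω).1 hp)
  have hisoζ : ∀ ω : BondConfig V, ω \ M' = u₀ → ∀ p ∈ ω ∆ M', z ∉ p := fun ω hω p hp =>
    hz p ((subset_union_of_fibre hω).2 hp)
  have h1 : fibreCount M' u₀ ({ω | s(z, c) ∉ ω} ∩ {ω | insert s(z, c) ω ∈ forestEv V ∩ P}) ({ω | s(z, c) ∉ ω} ∩ (forestEv V ∩ Q)) =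
      fibreCount M' u₀ (forestEv V ∩ P) (forestEv V ∩ Q) := by
    refine fibreCount_congr_fibre M' u₀ fun ω hω => ?_
    have hzω := notMem_of_isolated (hisoω ω hω) c
    have hzζ := notMem_of_isolated (hisoζ ω hω) c
    constructor
    · rintro ⟨⟨-, hF, hPω⟩, -, hB⟩
      exact ⟨⟨(isForestCfg_insert_of_isolated (hisoω ω hω) hzc).1 hF, (hP ω).1 hPω⟩, hB⟩
    · rintro ⟨⟨hF, hPω⟩, hB⟩
      exact ⟨⟨hzω, (isForestCfg_insert_of_isolated (hisoω ω hω) hzc).2 hF, (hP ω).2 hPω⟩, hzζ, hB⟩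
  have h2 : fibreCount M' u₀ ({ω | s(z, c) ∉ ω} ∩ (forestEv V ∩ P)) ({ω | s(z, c) ∉ ω} ∩ {ω | insert s(z, c) ω ∈ forestEv V ∩ Q}) =
      fibreCount M' u₀ (forestEv V ∩ P) (forestEv V ∩ Q) := by
    refine fibreCount_congr_fibre M' u₀ fun ω hω => ?_
    have hzω := notMem_of_isolated (hisoω ω hω) c
    have hzζ := notMem_of_isolated (hisoζ ω hω) c
    constructor
    · rintro ⟨⟨-, hA⟩, -, hF, hQζ⟩
      exact ⟨hA, (isForestCfg_insert_of_isolated (hisoζ ω hω) hzc).1 hF, (hQ _).1 hQζ⟩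
    · rintro ⟨hA, hF, hQζ⟩
      exact ⟨⟨hzω, hA⟩, hzζ, (isForestCfg_insert_of_isolated (hisoζ ω hω) hzc).2 hF, (hQ _).2 hQζ⟩
  rw [h1, h2]
  ring

end PendantFree

section Hub

variable {M₀ u₀ : BondConfig V} {o v y : V}

/-- **Hub of weighted degree two**: if `e = ov` and `f = oy` are free (`f ∉ M₀`, `e ∈ M₀`, fibre `(M₀ ∪ {f}, u₀)`) and `o` lies in no other
pair of the fibre, then `bad ≤ good`: dropping `f` from the first class maps bad colourings injectively to good ones, because `o` is
isolated in the partner class, which can therefore absorb `f`. [cite: CibulkaHladkyLaCroixWagner2008, Case 2(iii) (p. 4)] [cite: Linusson2011, Prop. 2.6] -/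
theorem adjForestNoSq_fibre_of_hubDegTwo (hoy : o ≠ y) (hfM : s(o, y) ∉ M₀) (heM : s(o, v) ∈ M₀) (hef : s(o, v) ≠ s(o, y))
    (ho : ∀ g ∈ M₀ ∪ u₀, o ∈ g → g = s(o, v)) :
    fibreCount (insert s(o, y) M₀) u₀ (forestEv V ∩ {ω | s(o, v) ∈ ω ∧ s(o, y) ∈ ω}) (forestEv V) ≤
      fibreCount (insert s(o, y) M₀) u₀ (forestEv V ∩ {ω | s(o, v) ∈ ω}) (forestEv V ∩ {ω | s(o, y) ∈ ω}) := by
  have hb0 : fibreCount (insert s(o, y) M₀) u₀ (forestEv V ∩ {ω | s(o, v) ∈ ω ∧ s(o, y) ∈ ω}) (forestEv V) =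
      fibreCount (insert s(o, y) M₀) u₀ (forestEv V ∩ {ω | s(o, v) ∈ ω ∧ s(o, y) ∈ ω}) (forestEv V ∩ univ) := by rw [inter_univ]
  rw [hb0, fibreCount_insert_one hfM, fibreCount_insert_one hfM]
  -- the `f ∈ ω` terms on the rest vanish (`f ∉ ω` there)
  have z1 : fibreCount M₀ u₀ ({ω | s(o, y) ∉ ω} ∩ (forestEv V ∩ {ω | s(o, v) ∈ ω ∧ s(o, y) ∈ ω}))
      ({ω | s(o, y) ∉ ω} ∩ {ω | insert s(o, y) ω ∈ forestEv V ∩ univ}) = 0 :=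
    fibreCount_eq_zero_of_forall _ _ _ _ fun ω _ hA _ => hA.1 hA.2.2.2
  have z2 : fibreCount M₀ u₀ ({ω | s(o, y) ∉ ω} ∩ {ω | insert s(o, y) ω ∈ forestEv V ∩ {ω | s(o, v) ∈ ω}})
      ({ω | s(o, y) ∉ ω} ∩ (forestEv V ∩ {ω | s(o, y) ∈ ω})) = 0 :=
    fibreCount_eq_zero_of_forall _ _ _ _ fun ω _ _ hB => hB.1 hB.2.2
  rw [z1, z2, add_zero, zero_add]
  refine fibreCount_mono_fibre M₀ u₀ fun ω hω hA hB => ?_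
  obtain ⟨hfω, hF, heω, -⟩ := hA
  obtain ⟨hfζ, hFζ, -⟩ := hB
  -- `o` is isolated in the partner `ω ∆ M₀`: its only possible pairs are `e` (in `ω ∩ M₀`) and `f` (absent)
  have heω' : s(o, v) ∈ ω := by
    rcases mem_insert_iff.1 heω with h | h
    · exact absurd h hef
    · exact h
  have hiso : ∀ p ∈ ω ∆ M₀, o ∉ p := by
    intro p hp hop
    have hpMu : p ∈ M₀ ∪ u₀ := (subset_union_of_fibre hω).2 hp
    have := ho p hpMu hop
    subst this
    exact ((mem_symmDiff.1 hp).elim (fun h => h.2 heM) (fun h => h.2 heω'))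
  refine ⟨⟨hfω, forestEv_of_subset hF (subset_insert _ _), heω'⟩, hfζ, ?_, mem_insert _ _⟩
  exact (isForestCfg_insert_of_isolated hiso hoy).2 hFζ

end Hub

section PendantEnd

variable {M u : BondConfig V} {o v y : V}

/-- **Pendant end `v`**: if `e = ov ∈ M` is free and `v` lies in no other pair of the fibre, then no second class joins `o` to `v`, so by
the e-toggle the bad and good counts coincide. [cite: CibulkaHladkyLaCroixWagner2008, Case 2(ii) (p. 4)] [cite: Linusson2011, Prop. 2.6] -/
theorem adjForestNoSq_bad_eq_good_of_pendantEnd (hov : o ≠ v) (heM : s(o, v) ∈ M) (hef : s(o, v) ≠ s(o, y))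
    (hv : ∀ g ∈ M ∪ u, v ∈ g → g = s(o, v)) :
    fibreCount M u (forestEv V ∩ {ω | s(o, v) ∈ ω ∧ s(o, y) ∈ ω}) (forestEv V) =
      fibreCount M u (forestEv V ∩ {ω | s(o, v) ∈ ω}) (forestEv V ∩ {ω | s(o, y) ∈ ω}) := by
  -- no configuration containing `e` has a partner joining `o` to `v`
  have hnone : ∀ ω : BondConfig V, ω \ M = u → s(o, v) ∈ ω → ω ∆ M ∉ reachEv o v := by
    intro ω hω heω hR
    have hiso : ∀ p ∈ ω ∆ M, v ∉ p := by
      intro p hp hvp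
      have := hv p ((subset_union_of_fibre hω).2 hp) hvp
      subst this
      exact ((mem_symmDiff.1 hp).elim (fun h => h.2 heM) (fun h => h.2 heω))
    exact not_reachable_of_isolated hiso hov (SimpleGraph.Reachable.symm hR) |>.elim
  have hb : fibreCount M u (forestEv V ∩ {ω | s(o, v) ∈ ω ∧ s(o, y) ∈ ω}) (forestEv V ∩ reachEv o v) = 0 :=
    fibreCount_eq_zero_of_forall _ _ _ _ fun ω hω hA hB => hnone ω hω hA.2.1 hB.2
  have hg : fibreCount M u (forestEv V ∩ {ω | s(o, v) ∈ ω}) (forestEv V ∩ {ω | s(o, y) ∈ ω} ∩ reachEv o v) = 0 :=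
    fibreCount_eq_zero_of_forall _ _ _ _ fun ω hω hA hB => hnone ω hω hA.2 hB.2
  -- split both counts by `reachEv o v` in the second slot; the complements are equal by the toggle, the rest vanish
  have hsplit : ∀ (A B : Set (BondConfig V)),
      fibreCount M u A (forestEv V ∩ B) =
        fibreCount M u A (forestEv V ∩ B ∩ reachEv o v) + fibreCount M u A (forestEv V ∩ B ∩ (reachEv o v)ᶜ) := by
    intro A B
    rw [← fibreCount_split_right M u A (Set.disjoint_of_subset inter_subset_right inter_subset_right
      disjoint_compl_right)]
    congr 1
    rw [← inter_union_distrib_left, union_compl_self, inter_univ]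
  have hkey : ∀ ω : BondConfig V, s(o, v) ∈ ω → ω ∆ M ∈ forestEv V →
      (ω ∆ M ∈ (reachEv o v)ᶜ ↔ insert s(o, v) (ω ∆ M) ∈ forestEv V) := by
    intro ω heω hF
    have heB : s(o, v) ∉ ω ∆ M := fun h => (mem_symmDiff.1 h).elim (fun h' => h'.2 heM) (fun h' => h'.2 heω)
    rw [insert_mem_forestEv_iff hov heB]
    exact ⟨fun hR => ⟨hF, hR⟩, fun h => h.2⟩
  have hbadc : fibreCount M u (forestEv V ∩ {ω | s(o, v) ∈ ω ∧ s(o, y) ∈ ω}) (forestEv V ∩ univ ∩ (reachEv o v)ᶜ) =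
      fibreCount M u (forestEv V ∩ {ω | s(o, v) ∈ ω ∧ s(o, y) ∈ ω}) (forestEv V ∩ {ζ | insert s(o, v) ζ ∈ forestEv V}) := by
    refine fibreCount_congr_fibre M u (fun ω _ => ?_)
    constructor
    · rintro ⟨hA, ⟨hF, -⟩, hR⟩; exact ⟨hA, hF, (hkey ω hA.2.1 hF).1 hR⟩
    · rintro ⟨hA, hF, hI⟩; exact ⟨hA, ⟨hF, mem_univ _⟩, (hkey ω hA.2.1 hF).2 hI⟩
  have hgoodc : fibreCount M u (forestEv V ∩ {ω | s(o, v) ∈ ω}) (forestEv V ∩ {ω | s(o, y) ∈ ω} ∩ (reachEv o v)ᶜ) =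
      fibreCount M u (forestEv V ∩ {ω | s(o, v) ∈ ω})
        (forestEv V ∩ {ζ | s(o, y) ∈ ζ} ∩ {ζ | insert s(o, v) ζ ∈ forestEv V}) := by
    refine fibreCount_congr_fibre M u (fun ω _ => ?_)
    constructor
    · rintro ⟨hA, ⟨hF, hf⟩, hR⟩; exact ⟨hA, ⟨hF, hf⟩, (hkey ω hA.2 hF).1 hR⟩
    · rintro ⟨hA, ⟨hF, hf⟩, hI⟩; exact ⟨hA, ⟨hF, hf⟩, (hkey ω hA.2 hF).2 hI⟩
  have heq := adjForestNoSq_bad_absorb_eq_good_absorb (u := u) heM hef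
  have h1 := hsplit (forestEv V ∩ {ω | s(o, v) ∈ ω ∧ s(o, y) ∈ ω}) univ
  have h2 := hsplit (forestEv V ∩ {ω | s(o, v) ∈ ω}) {ω | s(o, y) ∈ ω}
  rw [hbadc] at h1
  rw [hgoodc, ← heq] at h2
  rw [inter_univ] at h1
  rw [h1, h2, hb, hg]

/-- **Pendant end ⇒ the node** (inequality form). [cite: SempleWelsh2008, Conj. 1.1 (p. 2)] [cite: Linusson2011, Prop. 2.6] -/
theorem adjForestNoSq_fibre_of_pendantEnd (hov : o ≠ v) (heM : s(o, v) ∈ M) (hef : s(o, v) ≠ s(o, y))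
    (hv : ∀ g ∈ M ∪ u, v ∈ g → g = s(o, v)) :
    fibreCount M u (forestEv V ∩ {ω | s(o, v) ∈ ω ∧ s(o, y) ∈ ω}) (forestEv V) ≤
      fibreCount M u (forestEv V ∩ {ω | s(o, v) ∈ ω}) (forestEv V ∩ {ω | s(o, y) ∈ ω}) :=
  (adjForestNoSq_bad_eq_good_of_pendantEnd hov heM hef hv).le

end PendantEnd

end FK
end Summit.CriticalPhenomena.PercolationContinuityZ3.Theorems

end
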